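import Summits.MatrixMultiplication.MatrixMultiplication.Theses.LevelGradedCohnUmans
import Summits.MatrixMultiplication.MatrixMultiplication.Theorems.LevelTwoBeatsCubes.Negative.GradedNeumannCount
import Literature.RepresentationTheory.FiniteGroups.IrreducibleCharacters
import Literature.RepresentationTheory.FiniteGroups.BrauerTheorem

/-!
# `GradedPricing` (crux `stmt-MatrixMultiplication-7611`, route `LevelGradedCohnUmans`):
# abelian hosts are dead even under graded pricing (negative-side support)

Support file of the crux disprover (cdisprove seat, cycle 2).  The crux prices a `J`-separated
triple `X, Y, Z ⊆ G` (`J ≤ ℂ^G` bi-invariant) by the GRADED budget `Σᶠ_{χ ∈ Irr(G) ∩ J} χ(1)^ω`;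
the route's target `GradedDesignFamily` asks for such triples with
`Σᶠ_{χ ∈ Irr(G) ∩ J} χ(1)^{2+ε} < (|X||Y||Z|)^{(2+ε)/3}` for every `ε > 0`.  Proved here,
`sorry`-free, for every finite ABELIAN group `G`:

* `volume_le_finrank_of_comm` — **graded abelian packing**: if `J` is merely closed under right
  translations and `X, Y, Z` are `J`-separated then `|X|·|Y|·|Z| ≤ dim J` (the `|X||Y||Z|`
  functions `t ↦ f_{x₀z₀}(t·y₀⁻¹)` restrict to the distinct point indicators of `X⁻¹YZ`; uses the
  block-triangular evaluation count `card_add_card_le_finrank` of `GradedNeumannCount`);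
* `irrChar_mem_of_classInner_ne_zero`, `le_span_irrChars_inter_of_comm`,
  `finrank_le_card_irrChars_inter_of_comm` — Fourier support: a translation-invariant `J` is
  spanned by the characters it contains (`Σ_t χ(t⁻¹) f(·t) = |G|⟨f,χ⟩ χ ∈ J`), so
  `dim J ≤ #(Irr(G) ∩ J)`;
* `volume_le_gradedBudget_of_comm` — hence `|X||Y||Z| ≤ Σᶠ_{χ ∈ Irr(G) ∩ J} χ(1)^s` for EVERY real
  exponent `s` (all degrees are `1`), and `rpow_volume_le_gradedBudget_of_comm`:
  `(|X||Y||Z|)^{s/3} ≤ Σᶠ_{χ ∈ Irr(G) ∩ J} χ(1)^s` for `0 < s ≤ 3` — the crux's inequality holds in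
  abelian groups with `ω` replaced by any exponent up to `3`, i.e. with NO room below exponent `3`;
* `gradedDesignFamily_no_abelian_witness`, `not_abelianGradedDesignFamily` — consequently no
  abelian group can witness the target inequality at any `0 < ε ≤ 1`, and the abelian version
  of `GradedDesignFamily` (its body with `CommGroup` for `Group`, stated inline) is FALSE: the
  graded Cohn–Umans programme of this route needs
  non-abelian hosts exactly like the classical one (barrier-type knowledge; the classical
  statement is the injectivity of `(x,y,z) ↦ xyz` on a TPP triple, here refined from `|G|` to
  `dim J`).
-/

noncomputable section

set_option linter.dupNamespace false

open scoped BigOperators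
open Module Literature.RepresentationTheory.FiniteGroups

namespace Summit.MatrixMultiplication.MatrixMultiplication.Theorems.GradedPricing.Negative

variable {G : Type} [CommGroup G] [Fintype G]

/-! ## Graded abelian packing: `|X||Y||Z| ≤ dim J` -/

/-- **Graded abelian packing.**  In a finite abelian group, if `X, Y, Z` are separated by the
functions of a right-translation-invariant subspace `J ≤ ℂ^G` — for every target `(x₀, z₀)` some
`f ∈ J` has `f(x⁻¹ y y'⁻¹ z) = [x = x₀ ∧ y = y' ∧ z = z₀]` on `X × Y × Y × Z` — then
`|X|·|Y|·|Z| ≤ dim J`: the translate `t ↦ f_{x₀z₀}(t y₀⁻¹)` lies in `J` and, by commutativity,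
restricts on the points `x⁻¹ y z` to the indicator of `(x₀, y₀, z₀)`, so evaluation
`J → ℂ^{X × Y × Z}` is onto. [folklore] -/
theorem volume_le_finrank_of_comm (J : Submodule ℂ (G → ℂ))
    (hJ : ∀ f ∈ J, ∀ a : G, (fun g => f (g * a)) ∈ J) (X Y Z : Finset G)
    (hsep : ∀ x₀ ∈ X, ∀ z₀ ∈ Z, ∃ f ∈ J, ∀ x ∈ X, ∀ y ∈ Y, ∀ y' ∈ Y, ∀ z ∈ Z,
      (x = x₀ ∧ y = y' ∧ z = z₀ → f (x⁻¹ * y * y'⁻¹ * z) = 1) ∧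
      (¬ (x = x₀ ∧ y = y' ∧ z = z₀) → f (x⁻¹ * y * y'⁻¹ * z) = 0)) :
    X.card * Y.card * Z.card ≤ finrank ℂ J := by
  classical
  have h := LevelTwoBeatsCubes.Negative.card_add_card_le_finrank
    (A := ↥(X ×ˢ Y ×ˢ Z)) (S := Fin 0) J
    (fun a => a.1.1⁻¹ * a.1.2.1 * a.1.2.2) Fin.elim0 ?_ (fun s => Fin.elim0 s)
  · simp only [Fintype.card_coe, Fintype.card_fin, add_zero] at h
    rw [Finset.card_product, Finset.card_product, ← mul_assoc] at h
    exact h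
  · rintro ⟨⟨x₀, y₀, z₀⟩, h₀⟩
    simp only [Finset.mem_product] at h₀
    obtain ⟨f, hf, hspec⟩ := hsep x₀ h₀.1 z₀ h₀.2.2
    refine ⟨fun t => f (t * y₀⁻¹), hJ f hf _, ?_, ?_, fun s => Fin.elim0 s⟩
    · show f (x₀⁻¹ * y₀ * z₀ * y₀⁻¹) = 1
      rw [mul_right_comm (x₀⁻¹ * y₀) z₀ y₀⁻¹]
      exact (hspec x₀ h₀.1 y₀ h₀.2.1 y₀ h₀.2.1 z₀ h₀.2.2).1 ⟨rfl, rfl, rfl⟩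
    · rintro ⟨⟨x, y, z⟩, hxyz⟩ hne
      simp only [Finset.mem_product] at hxyz
      show f (x⁻¹ * y * z * y₀⁻¹) = 0
      rw [mul_right_comm (x⁻¹ * y) z y₀⁻¹]
      refine (hspec x hxyz.1 y hxyz.2.1 y₀ h₀.2.1 z hxyz.2.2).2 ?_
      rintro ⟨rfl, rfl, rfl⟩
      exact hne rfl

/-! ## Fourier support of a translation-invariant subspace -/

/-- In a finite abelian group a right-translation-invariant subspace `J` contains every
irreducible character `χ` pairing non-trivially with one of its members:
`Σ_t χ(t⁻¹) f(g t) = (Σ_s f(s) χ(s⁻¹)) χ(g)`, and the left side is a combination of translates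
of `f`. [folklore] -/
theorem irrChar_mem_of_classInner_ne_zero (J : Submodule ℂ (G → ℂ))
    (hJ : ∀ f ∈ J, ∀ a : G, (fun g => f (g * a)) ∈ J) {f χ : G → ℂ} (hf : f ∈ J)
    (hχ : IsIrrChar G χ) (hne : classInner f χ ≠ 0) : χ ∈ J := by
  haveI : IsMulCommutative G := ⟨⟨mul_comm⟩⟩
  set c : ℂ := ∑ s : G, f s * χ s⁻¹ with hc
  have hc0 : c ≠ 0 := by
    intro h0
    apply hne
    rw [classInner_apply, ← hc, h0, mul_zero]
  have hF : (fun g => ∑ t : G, χ t⁻¹ * f (g * t)) ∈ J := by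
    have e : (fun g => ∑ t : G, χ t⁻¹ * f (g * t)) = ∑ t : G, χ t⁻¹ • (fun g => f (g * t)) := by
      funext g
      simp only [Finset.sum_apply, Pi.smul_apply, smul_eq_mul]
    rw [e]
    exact Submodule.sum_mem _ fun t _ => Submodule.smul_mem _ _ (hJ f hf t)
  have hkey : (fun g => ∑ t : G, χ t⁻¹ * f (g * t)) = c • χ := by
    funext g
    rw [Pi.smul_apply, smul_eq_mul]
    calc ∑ t : G, χ t⁻¹ * f (g * t)
        = ∑ s : G, χ (g⁻¹ * s)⁻¹ * f (g * (g⁻¹ * s)) :=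
          Fintype.sum_equiv (Equiv.mulLeft g) _ _ (fun t => by
            simp only [Equiv.coe_mulLeft, inv_mul_cancel_left])
      _ = ∑ s : G, f s * χ s⁻¹ * χ g := by
          refine Finset.sum_congr rfl fun s _ => ?_
          rw [mul_inv_rev, inv_inv, mul_inv_cancel_left, hχ.map_mul]
          ring
      _ = c * χ g := by rw [hc, Finset.sum_mul]
  have hχeq : χ = c⁻¹ • (fun g => ∑ t : G, χ t⁻¹ * f (g * t)) := by
    rw [hkey, smul_smul, inv_mul_cancel₀ hc0, one_smul]
  rw [hχeq]
  exact Submodule.smul_mem _ _ hF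

/-- Hence a right-translation-invariant subspace of `ℂ^G` (`G` finite abelian) is spanned by the
irreducible characters it contains (Fourier expansion `f = Σ_χ ⟨f, χ⟩ χ`,
`IsClassFun.eq_sum_classInner_smul`; every function on an abelian group is a class function). [folklore] -/
theorem le_span_irrChars_inter_of_comm (J : Submodule ℂ (G → ℂ))
    (hJ : ∀ f ∈ J, ∀ a : G, (fun g => f (g * a)) ∈ J) :
    J ≤ Submodule.span ℂ (irrChars G ∩ (J : Set (G → ℂ))) := by
  intro f hf
  have hcl : IsClassFun f := fun s t => by rw [mul_comm t s, mul_inv_cancel_right]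
  rw [hcl.eq_sum_classInner_smul]
  refine Submodule.sum_mem _ fun χ hχ => ?_
  have hχ' : IsIrrChar G χ := (irrChars_finite_holds G).mem_toFinset.mp hχ
  by_cases h0 : classInner f χ = 0
  · rw [h0, zero_smul]
    exact Submodule.zero_mem _
  · exact Submodule.smul_mem _ _
      (Submodule.subset_span ⟨hχ', irrChar_mem_of_classInner_ne_zero J hJ hf hχ' h0⟩)

/-- The set `Irr(G) ∩ J` is finite. [folklore] -/
theorem irrChars_inter_finite' {H : Type} [Group H] [Finite H] (J : Submodule ℂ (H → ℂ)) :
    (irrChars H ∩ (J : Set (H → ℂ))).Finite :=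
  (irrChars_finite_holds H).subset Set.inter_subset_left

/-- `dim J ≤ #(Irr(G) ∩ J)` for a right-translation-invariant `J` in a finite abelian group. [folklore] -/
theorem finrank_le_card_irrChars_inter_of_comm (J : Submodule ℂ (G → ℂ))
    (hJ : ∀ f ∈ J, ∀ a : G, (fun g => f (g * a)) ∈ J) :
    finrank ℂ J ≤ (irrChars_inter_finite' J).toFinset.card := by
  have hle := le_span_irrChars_inter_of_comm J hJ
  have hspan : Submodule.span ℂ (irrChars G ∩ (J : Set (G → ℂ)))
      = Submodule.span ℂ ((irrChars_inter_finite' J).toFinset : Set (G → ℂ)) := by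
    rw [Set.Finite.coe_toFinset]
  calc finrank ℂ J ≤ finrank ℂ (Submodule.span ℂ (irrChars G ∩ (J : Set (G → ℂ)))) :=
        Submodule.finrank_mono hle
    _ = finrank ℂ (Submodule.span ℂ ((irrChars_inter_finite' J).toFinset : Set (G → ℂ))) := by
        rw [hspan]
    _ ≤ (irrChars_inter_finite' J).toFinset.card := finrank_span_finset_le_card _

/-- In a finite abelian group the graded budget at ANY real exponent `s` is the number of
characters in `J`: `Σᶠ_{χ ∈ Irr(G) ∩ J} χ(1)^s = #(Irr(G) ∩ J)` (all degrees are `1`). [folklore] -/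
theorem gradedBudget_eq_card_of_comm (J : Submodule ℂ (G → ℂ)) (s : ℝ) :
    ∑ᶠ χ ∈ irrChars G ∩ (J : Set (G → ℂ)), (χ 1).re ^ s
      = ((irrChars_inter_finite' J).toFinset.card : ℝ) := by
  haveI : IsMulCommutative G := ⟨⟨mul_comm⟩⟩
  rw [finsum_mem_eq_finite_toFinset_sum _ (irrChars_inter_finite' J)]
  have : ∀ χ ∈ (irrChars_inter_finite' J).toFinset, (χ 1).re ^ s = 1 := by
    intro χ hχ
    have hχ' : IsIrrChar G χ := ((irrChars_inter_finite' J).mem_toFinset.mp hχ).1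
    rw [hχ'.map_one, Complex.one_re, Real.one_rpow]
  rw [Finset.sum_congr rfl this, Finset.sum_const, nsmul_eq_mul, mul_one]

/-! ## Consequences: the graded budget of an abelian host is never beaten -/

/-- Right-translation invariance from the crux's bi-invariance hypothesis. [folklore] -/
theorem rightInv_of_biInv {H : Type} [Group H] (J : Submodule ℂ (H → ℂ))
    (hJ : ∀ f ∈ J, ∀ a b : H, (fun g : H => f (a * g * b)) ∈ J) :
    ∀ f ∈ J, ∀ a : H, (fun g => f (g * a)) ∈ J := by
  intro f hf a
  have h := hJ f hf 1 a
  simp only [one_mul] at h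
  exact h

/-- **Graded abelian packing, budget form.**  For a finite abelian `G`, a bi-invariant `J` and a
`J`-separated triple, `|X||Y||Z| ≤ Σᶠ_{χ ∈ Irr(G) ∩ J} χ(1)^s` for EVERY real `s`. [folklore] -/
theorem volume_le_gradedBudget_of_comm (J : Submodule ℂ (G → ℂ))
    (hJ : ∀ f ∈ J, ∀ a b : G, (fun g : G => f (a * g * b)) ∈ J) (X Y Z : Finset G)
    (hsep : ∀ x₀ ∈ X, ∀ z₀ ∈ Z, ∃ f ∈ J, ∀ x ∈ X, ∀ y ∈ Y, ∀ y' ∈ Y, ∀ z ∈ Z,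
      (x = x₀ ∧ y = y' ∧ z = z₀ → f (x⁻¹ * y * y'⁻¹ * z) = 1) ∧
      (¬ (x = x₀ ∧ y = y' ∧ z = z₀) → f (x⁻¹ * y * y'⁻¹ * z) = 0)) (s : ℝ) :
    ((X.card * Y.card * Z.card : ℕ) : ℝ) ≤ ∑ᶠ χ ∈ irrChars G ∩ (J : Set (G → ℂ)), (χ 1).re ^ s := by
  rw [gradedBudget_eq_card_of_comm]
  exact_mod_cast (volume_le_finrank_of_comm J (rightInv_of_biInv J hJ) X Y Z hsep).trans
    (finrank_le_card_irrChars_inter_of_comm J (rightInv_of_biInv J hJ))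

/-- **The crux's inequality with `ω` replaced by ANY exponent `0 < s ≤ 3` holds in abelian groups**:
`(|X||Y||Z|)^{s/3} ≤ Σᶠ_{χ ∈ Irr(G) ∩ J} χ(1)^s`.  (At `s = 3` this is the graded form of the
classical "abelian groups cannot beat `n³`"; for the crux itself, `s = ω ≤ 3`.) [folklore] -/
theorem rpow_volume_le_gradedBudget_of_comm (J : Submodule ℂ (G → ℂ))
    (hJ : ∀ f ∈ J, ∀ a b : G, (fun g : G => f (a * g * b)) ∈ J) (X Y Z : Finset G)
    (hsep : ∀ x₀ ∈ X, ∀ z₀ ∈ Z, ∃ f ∈ J, ∀ x ∈ X, ∀ y ∈ Y, ∀ y' ∈ Y, ∀ z ∈ Z,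
      (x = x₀ ∧ y = y' ∧ z = z₀ → f (x⁻¹ * y * y'⁻¹ * z) = 1) ∧
      (¬ (x = x₀ ∧ y = y' ∧ z = z₀) → f (x⁻¹ * y * y'⁻¹ * z) = 0))
    {s : ℝ} (hs0 : 0 < s) (hs3 : s ≤ 3) :
    ((X.card * Y.card * Z.card : ℕ) : ℝ) ^ (s / 3)
      ≤ ∑ᶠ χ ∈ irrChars G ∩ (J : Set (G → ℂ)), (χ 1).re ^ s := by
  have hV := volume_le_gradedBudget_of_comm J hJ X Y Z hsep s
  rcases Nat.eq_zero_or_pos (X.card * Y.card * Z.card) with h0 | hpos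
  · rw [h0, Nat.cast_zero, Real.zero_rpow (div_pos hs0 three_pos).ne']
    rw [h0, Nat.cast_zero] at hV
    exact hV
  · have h1 : (1 : ℝ) ≤ ((X.card * Y.card * Z.card : ℕ) : ℝ) := by exact_mod_cast hpos
    calc ((X.card * Y.card * Z.card : ℕ) : ℝ) ^ (s / 3)
        ≤ ((X.card * Y.card * Z.card : ℕ) : ℝ) ^ (1 : ℝ) :=
          Real.rpow_le_rpow_of_exponent_le h1 (by linarith)
      _ = ((X.card * Y.card * Z.card : ℕ) : ℝ) := Real.rpow_one _
      _ ≤ _ := hV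

/-- **No abelian witness for the route's target at any `0 < ε ≤ 1`.**  For a finite abelian `G`, a
bi-invariant `J` and a `J`-separated triple, the inequality demanded by `GradedDesignFamily`,
`Σᶠ_{χ ∈ Irr(G) ∩ J} χ(1)^{2+ε} < (|X||Y||Z|)^{(2+ε)/3}`, is false. [folklore] -/
theorem gradedDesignFamily_no_abelian_witness {ε : ℝ} (hε : 0 < ε) (hε1 : ε ≤ 1)
    (J : Submodule ℂ (G → ℂ))
    (hJ : ∀ f ∈ J, ∀ a b : G, (fun g : G => f (a * g * b)) ∈ J) (X Y Z : Finset G)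
    (hsep : ∀ x₀ ∈ X, ∀ z₀ ∈ Z, ∃ f ∈ J, ∀ x ∈ X, ∀ y ∈ Y, ∀ y' ∈ Y, ∀ z ∈ Z,
      (x = x₀ ∧ y = y' ∧ z = z₀ → f (x⁻¹ * y * y'⁻¹ * z) = 1) ∧
      (¬ (x = x₀ ∧ y = y' ∧ z = z₀) → f (x⁻¹ * y * y'⁻¹ * z) = 0)) :
    ¬ (∑ᶠ χ ∈ irrChars G ∩ (J : Set (G → ℂ)), (χ 1).re ^ (2 + ε))
        < ((X.card * Y.card * Z.card : ℕ) : ℝ) ^ ((2 + ε) / 3) :=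
  not_lt.mpr (rpow_volume_le_gradedBudget_of_comm J hJ X Y Z hsep (by linarith) (by linarith))

/-- **Abelian hosts are dead even under graded pricing**: the route's target `GradedDesignFamily`
RESTRICTED TO ABELIAN HOSTS (same body, `CommGroup` in place of `Group`) is false (instantiate
`ε = 1` and use `gradedDesignFamily_no_abelian_witness`).  Any witness family for
`GradedDesignFamily` must therefore use non-abelian groups for all small `ε`. [folklore] -/
theorem not_abelianGradedDesignFamily :
    ¬ ∀ ε : ℝ, 0 < ε → ∃ (G : Type) (_ : CommGroup G) (_ : Fintype G) (J : Submodule ℂ (G → ℂ))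
      (X Y Z : Finset G), (∀ f ∈ J, ∀ a b : G, (fun g : G => f (a * g * b)) ∈ J) ∧
      (∀ x₀ ∈ X, ∀ z₀ ∈ Z, ∃ f ∈ J, ∀ x ∈ X, ∀ y ∈ Y, ∀ y' ∈ Y, ∀ z ∈ Z,
        (x = x₀ ∧ y = y' ∧ z = z₀ → f (x⁻¹ * y * y'⁻¹ * z) = 1) ∧
        (¬ (x = x₀ ∧ y = y' ∧ z = z₀) → f (x⁻¹ * y * y'⁻¹ * z) = 0)) ∧
      (∑ᶠ χ ∈ irrChars G ∩ (J : Set (G → ℂ)), (χ 1).re ^ (2 + ε))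
        < ((X.card * Y.card * Z.card : ℕ) : ℝ) ^ ((2 + ε) / 3) := by
  intro h
  obtain ⟨G, _, _, J, X, Y, Z, hJ, hsep, hlt⟩ := h 1 one_pos
  exact gradedDesignFamily_no_abelian_witness one_pos le_rfl J hJ X Y Z hsep hlt

end Summit.MatrixMultiplication.MatrixMultiplication.Theorems.GradedPricing.Negative

end
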